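import Mathlib
import HarnessLib
import Literature.MathematicalPhysics.StatisticalMechanics.PolymerProductABKM
import Literature.MathematicalPhysics.StatisticalMechanics.RenormalisationMapExpansion

/-!
# Splitting `P₂(e^{−H},K)(Z)` into its first-order terms and a second-order rest ([ABKM19] Ch. 9.1 / Lemma 9.4)

For a non-empty `k`-polymer `Z` the polynomial map `P₂(e^{−H},K)(Z) = Σ_{Y ∈ 𝓟_k(Z)} (e^{−H}−1)^{Z∖Y} K(Y)`
(`GradientRG.polyP2`) has exactly two terms of degree `≤ 1` in `(H, K)`: `Y = Z` (the term `K(Z)`, using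
`(e^{−H}−1)^∅ = 1`) and `Y = ∅` (the term `(e^{−H}−1)^Z`, using `K(∅) = 1`); every other `Y` carries at
least one factor `e^{−H(B)} − 1` AND at least one factor `K`.  In the Lipschitz estimate of the
renormalisation map `S(H,K)` ([ABKM19] Thm 6.7 at first order; the crux line's `IsRGStepQ.lipschitz`) the
two first-order terms are absorbed into the linearisation `C_k` (together with the single-block terms of
the outer sum), and only the rest needs the second-order bound.  This file provides the split and the
bound of the rest for the torus data:

* `sum_polys_eq_add_add_sum_rest` — `Σ_{Y ∈ 𝓟(Z)} f(Y) = f(Z) + f(∅) + Σ_{Y ∈ 𝓟(Z), Y ≠ Z, Y ≠ ∅} f(Y)`;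
* **`polyP2_eq_add_add_rest`** — `P₂(Z) = K(Z) + (e^{−H}−1)^Z + Σ_{∅ ≠ Y ⊊ Z} (e^{−H}−1)^{Z∖Y} K(Y)`;
* `tayNormLE_subsum_bprod_mul` — the abstract brick `PolymerProductBound.tayNormLE_sum_bprod_mul` for an
  arbitrary sub-family of `𝓟_k(X)`;
* **`tayNormLE_polyP2Rest_abkm`** — the rest obeys
  `|Σ_{∅≠Y⊊Z} (e^{−H}−1)^{Z∖Y}K(Y)|_{T_Z, w_k^Z} ≤ Σ_{∅≠Y⊊Z} (8e^{1/4}‖H‖_{k,0})^{|𝓑(Z∖Y)|} ∏_{W∈𝓒(Y)} C A^{−|W|_k}`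
  (each summand has `|𝓑(Z∖Y)| ≥ 1` and `|𝓒(Y)| ≥ 1`: second order).

Everything is proved; no named fact.

## References
* S. Adams, S. Buchholz, R. Kotecký, S. Müller, arXiv:1910.13564, Ch. 9.1 (the maps `P₁`, `P₂`),
  Lemma 9.4 (9.19), proof of Theorem 6.7 [AdamsBuchholzKoteckyMuller2019].
-/

noncomputable section

namespace Literature.MathematicalPhysics.StatisticalMechanics.GradientRG

open scoped BigOperators Classical
open Finset Matrix
open Literature.MathematicalPhysics.StatisticalMechanics.TorusPolymer
  (IsPolymer Separated blocks polys bprod blockOf thicken mem_polys mem_blocks isPolymer_blockOf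
    isPolymer_empty)
open Literature.Barriers.CriticalPhenomena.LongRangePhi4.Polymer (IsConn components)
open Literature.MathematicalPhysics.QuantumFieldTheory

variable {d M : ℕ} [NeZero M]

/-! ## The split of the sum over `𝓟_k(Z)` -/

/-- `Σ_{Y ∈ 𝓟_k(Z)} f(Y) = f(Z) + f(∅) + Σ_{Y ∈ 𝓟_k(Z) ∖ {Z, ∅}} f(Y)` for a non-empty `k`-polymer `Z`.
[cite: AdamsBuchholzKoteckyMuller2019, Ch. 9.1] -/
theorem sum_polys_eq_add_add_sum_rest {A : Type*} [AddCommGroup A] {s : ℕ} {Z : Finset (Fin d → ZMod M)}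
    (hZ : IsPolymer s Z) (hZne : Z.Nonempty) (f : Finset (Fin d → ZMod M) → A) :
    ∑ Y ∈ polys s Z, f Y = f Z + f ∅ + ∑ Y ∈ ((polys s Z).erase Z).erase ∅, f Y := by
  have hZm : Z ∈ polys s Z := TorusPolymer.self_mem_polys hZ
  have h0m : (∅ : Finset (Fin d → ZMod M)) ∈ (polys s Z).erase Z :=
    mem_erase.2 ⟨fun h => hZne.ne_empty h.symm, TorusPolymer.empty_mem_polys s Z⟩
  rw [← add_sum_erase _ _ hZm, ← add_sum_erase _ _ h0m, add_assoc]

/-- **`P₂(e^{−H},K)(Z) = K(Z) + (e^{−H}−1)^Z + Σ_{∅ ≠ Y ⊊ Z} (e^{−H}−1)^{Z∖Y} K(Y)`** for a non-empty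
`k`-polymer `Z` and `K(∅) = 1`. [cite: AdamsBuchholzKoteckyMuller2019, Ch. 9.1 (P₂ = (I−1) ∘ K)] -/
theorem polyP2_eq_add_add_rest {s : ℕ} (H : RelevantHamiltonian ℂ d)
    {K : Finset (Fin d → ZMod M) → ((Fin d → ZMod M) → ℝ) → ℂ} (hK0 : ∀ φ, K ∅ φ = 1)
    {Z : Finset (Fin d → ZMod M)} (hZ : IsPolymer s Z) (hZne : Z.Nonempty) (ψ : (Fin d → ZMod M) → ℝ) :
    polyP2 s H K Z ψ = K Z ψ + bprod s (fun B => expNegH H B ψ - 1) Z +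
      ∑ Y ∈ ((polys s Z).erase Z).erase ∅, bprod s (fun B => expNegH H B ψ - 1) (Z \ Y) * K Y ψ := by
  unfold polyP2
  rw [sum_polys_eq_add_add_sum_rest hZ hZne]
  rw [Finset.sdiff_self, TorusPolymer.bprod_empty, one_mul, sdiff_empty, hK0, mul_one]

/-! ## The abstract brick on a sub-family -/

variable {V : Type*} [NormedAddCommGroup V] [NormedSpace ℝ V]
  {Vb : Finset (Fin d → ZMod M) → Type*} [∀ B, NormedAddCommGroup (Vb B)] [∀ B, NormedSpace ℝ (Vb B)]
  {Vp : Finset (Fin d → ZMod M) → Type*} [∀ Y, NormedAddCommGroup (Vp Y)] [∀ Y, NormedSpace ℝ (Vp Y)]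

/-- `PolymerProductBound.tayNormLE_sum_bprod_mul` for a sub-family `𝓨 ⊆ 𝓟_k(X)`:
`|Σ_{Y ∈ 𝓨} F^{X∖Y} K(Y)|_{T,w} ≤ Σ_{Y ∈ 𝓨} (∏_{B∈𝓑(X∖Y)} a_B) c_Y`.
[cite: AdamsBuchholzKoteckyMuller2019, Lemma 9.4 (9.19)] -/
theorem tayNormLE_subsum_bprod_mul (s : ℕ) (T : ((Fin d → ZMod M) → ℝ) →ₗ[ℝ] V)
    (Tb : ∀ B : Finset (Fin d → ZMod M), ((Fin d → ZMod M) → ℝ) →ₗ[ℝ] Vb B)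
    (Tp : ∀ Y : Finset (Fin d → ZMod M), ((Fin d → ZMod M) → ℝ) →ₗ[ℝ] Vp Y) {r₀ : ℕ}
    {W wp : Finset (Fin d → ZMod M) → ((Fin d → ZMod M) → ℝ) → ℝ} {w : ((Fin d → ZMod M) → ℝ) → ℝ}
    {F K : Finset (Fin d → ZMod M) → ((Fin d → ZMod M) → ℝ) → ℂ}
    {a c : Finset (Fin d → ZMod M) → ℝ} (X : Finset (Fin d → ZMod M))
    {𝓨 : Finset (Finset (Fin d → ZMod M))} (h𝓨 : 𝓨 ⊆ polys s X)
    (hF : ∀ B ∈ blocks s X, TayNormLE (Tb B) r₀ (W B) (F B) (a B))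
    (hleb : ∀ B ∈ blocks s X, ∀ ξ, ‖Tb B ξ‖ ≤ ‖T ξ‖)
    (hFd : ∀ B ∈ blocks s X, ContDiff ℝ r₀ (F B))
    (hFloc : ∀ B ∈ blocks s X, IsGaugeLocal (Tb B) (F B)) (ha : ∀ B ∈ blocks s X, 0 ≤ a B)
    (hK : ∀ Y ∈ polys s X, TayNormLE (Tp Y) r₀ (wp Y) (K Y) (c Y))
    (hlep : ∀ Y ∈ polys s X, ∀ ξ, ‖Tp Y ξ‖ ≤ ‖T ξ‖)
    (hKd : ∀ Y ∈ polys s X, ContDiff ℝ r₀ (K Y))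
    (hKloc : ∀ Y ∈ polys s X, IsGaugeLocal (Tp Y) (K Y)) (hc : ∀ Y ∈ polys s X, 0 ≤ c Y)
    (hw : ∀ Y ∈ polys s X, ∀ φ, (∏ B ∈ blocks s (X \ Y), W B φ) * wp Y φ ≤ w φ) :
    TayNormLE T r₀ w (fun φ => ∑ Y ∈ 𝓨, bprod s (fun B => F B φ) (X \ Y) * K Y φ)
      (∑ Y ∈ 𝓨, (∏ B ∈ blocks s (X \ Y), a B) * c Y) := by
  have hterm : ∀ Y ∈ 𝓨, TayNormLE T r₀ w
      (fun φ => bprod s (fun B => F B φ) (X \ Y) * K Y φ) ((∏ B ∈ blocks s (X \ Y), a B) * c Y) := by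
    intro Y hY'
    have hY := h𝓨 hY'
    have hsub : blocks s (X \ Y) ⊆ blocks s X := TorusPolymer.blocks_mono s sdiff_subset
    have h1 := tayNormLE_bprod s T Tb (X \ Y) (fun B hB => hF B (hsub hB)) (fun B hB => hleb B (hsub hB))
      (fun B hB => hFd B (hsub hB)) (fun B hB => hFloc B (hsub hB)) (fun B hB => ha B (hsub hB))
    have hprodCD : ContDiff ℝ r₀ (fun φ => bprod s (fun B => F B φ) (X \ Y)) := by
      unfold TorusPolymer.bprod
      exact contDiff_prod fun B hB => hFd B (hsub hB)
    have hprodloc : IsGaugeLocal T (fun φ => bprod s (fun B => F B φ) (X \ Y)) := by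
      unfold TorusPolymer.bprod
      exact IsGaugeLocal.prod _ fun B hB => (hFloc B (hsub hB)).of_norm_le (hleb B (hsub hB))
    exact TayNormLE.mul (T := T) (w := w) h1 (hK Y hY) (fun ξ => le_rfl) (hlep Y hY) hprodCD (hKd Y hY)
      hprodloc (hKloc Y hY) (Finset.prod_nonneg fun B hB => ha B (hsub hB)) (hc Y hY) (hw Y hY)
  exact TayNormLE.sum (T := T) (r₀ := r₀) (w := w) 𝓨 hterm fun Y hY' => by
    have hY := h𝓨 hY'
    have hsub : blocks s (X \ Y) ⊆ blocks s X := TorusPolymer.blocks_mono s sdiff_subset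
    have hprodCD : ContDiff ℝ r₀ (fun φ => bprod s (fun B => F B φ) (X \ Y)) := by
      unfold TorusPolymer.bprod
      exact contDiff_prod fun B hB => hFd B (hsub hB)
    exact hprodCD.mul (hKd Y hY)

/-! ## The rest of `P₂` for the torus data -/

/-- **The second-order rest of `P₂(e^{−H},K)(X)` for the torus data**: under the hypotheses of
`PolymerProductABKM.tayNormLE_P2_abkm`, for every sub-family `𝓨 ⊆ 𝓟_k(X)` (in particular
`𝓨 = 𝓟_k(X) ∖ {X, ∅}`):
`|Σ_{Y ∈ 𝓨} (e^{−H}−1)^{X∖Y} K(Y)|_{T_X, w_k^X} ≤ Σ_{Y ∈ 𝓨} (8e^{1/4}‖H‖_{k,0})^{|𝓑(X∖Y)|} ∏_{W ∈ 𝓒(Y)} C A^{−|W|_k}`.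
[cite: AdamsBuchholzKoteckyMuller2019, Lemma 9.4 (9.19)] -/
theorem tayNormLE_polyP2Rest_abkm {L N Mord R n p r₀ : ℕ} {θbar lam μ δ₁ δ₀ A𝒫 h A : ℝ}
    {𝒞 : ℕ → (Fin d → ZMod M) → ℝ} (hd : 2 ≤ d) (hLodd : Odd L)
    (hM : M = L ^ N) {k : ℕ} (hkN : k + 1 ≤ N) (hp : d / 2 + 1 ≤ p) (hMord : d / 2 + 1 ≤ Mord)
    (hB : AbkmWeightBounds L N Mord R n θbar lam μ δ₁ δ₀ A𝒫 𝒞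
      (abkmWeightData L N Mord R θbar (schedDelta δ₀ δ₁ N) 𝒞))
    (hδ₀ : 0 < δ₀) (hδ₁ : 0 < δ₁) (hh : 0 < h) (hh0 : hZeroSq d R δ₀ δ₁ ≤ h ^ 2) (hA : 0 < A)
    {X : Finset (Fin d → ZMod M)} (hX : IsPolymer (L ^ k) X)
    {𝓨 : Finset (Finset (Fin d → ZMod M))} (h𝓨 : 𝓨 ⊆ polys (L ^ k) X)
    {H : RelevantHamiltonian ℂ d}
    (hH : hamNorm (fieldWt h (L : ℝ) d k) ((L : ℝ) ^ k) (L ^ (d * k)) H ≤ 1 / 8)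
    {K : Finset (Fin d → ZMod M) → ((Fin d → ZMod M) → ℝ) → ℂ} {C : ℝ} (hC : 0 ≤ C)
    (hK : WeakNormLE (abkmNormParams L N Mord R p r₀ h θbar A (schedDelta δ₀ δ₁ N) 𝒞) k K C)
    (hKfac : Factorises (L ^ k) K) (hK0 : ∀ φ, K ∅ φ = 1) (hKd : ∀ Y, ContDiff ℝ r₀ (K Y))
    (hKloc : ∀ Y, IsPolymer (L ^ k) Y → IsConn Y →
      IsGaugeLocal ((abkmNormParams L N Mord R p r₀ h θbar A (schedDelta δ₀ δ₁ N) 𝒞).gauge k Y) (K Y)) :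
    TayNormLE ((abkmNormParams L N Mord R p r₀ h θbar A (schedDelta δ₀ δ₁ N) 𝒞).gauge k X) r₀
      ((abkmWeightData L N Mord R θbar (schedDelta δ₀ δ₁ N) 𝒞).weight k X)
      (fun φ => ∑ Y ∈ 𝓨, bprod (L ^ k) (fun B => expNegH H B φ - 1) (X \ Y) * K Y φ)
      (∑ Y ∈ 𝓨, (∏ _B ∈ blocks (L ^ k) (X \ Y),
        8 * Real.exp (1 / 4) * hamNorm (fieldWt h (L : ℝ) d k) ((L : ℝ) ^ k) (L ^ (d * k)) H) *
        ∏ Z ∈ components Y, C * (abkmNormParams L N Mord R p r₀ h θbar A (schedDelta δ₀ δ₁ N) 𝒞).aFactor k Z) := by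
  set P := abkmNormParams L N Mord R p r₀ h θbar A (schedDelta δ₀ δ₁ N) 𝒞 with hP
  set W := abkmWeightData L N Mord R θbar (schedDelta δ₀ δ₁ N) 𝒞 with hW
  set s := L ^ k with hs
  have hkN' : k ≤ N := by omega
  have hL0 : (0 : ℝ) < L := by exact_mod_cast hLodd.pos
  obtain ⟨t, ht⟩ : ∃ t, N = k + t := ⟨N - k, by omega⟩
  have hMt : M = s * L ^ t := by rw [hs, ← pow_add, ← ht]; exact hM
  have htodd : Odd (L ^ t) := hLodd.pow
  have hsodd : Odd s := hLodd.pow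
  have h𝔥 : 0 < P.𝔥 k := fieldWt_pos hh hL0 d k
  have hR : 0 < P.R k := by show (0 : ℝ) < (L : ℝ) ^ k; positivity
  -- strong family and (w5)
  set G : ℕ → Finset (Fin d → ZMod M) → Matrix (Fin d → ZMod M) (Fin d → ZMod M) ℝ :=
    fun j Y => strongCoef h N j • derivForm (L : ℝ) j (diffIndex d Mord)
      (boxDensity (boxRad R L j) (boxWt (L : ℝ) d j) Y) with hG
  have hGs : W.StrongDominated G fun _ X Y => Disjoint X Y :=
    hB.strong (diffIndex d Mord) (fun α hα => hα) (strongCoef h N) (strongCoef_le hδ₀ hδ₁ hh hh0)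
  have hgauge : ∀ Y ⊆ X, ∀ ξ, ‖P.gauge k Y ξ‖ ≤ ‖P.gauge k X ξ‖ := fun Y hY ξ =>
    norm_fieldGauge_mono_set _ _ _ (TorusPolymer.thicken_mono _ hY) ξ
  have hcard : ∀ x, (blockOf s x).card = L ^ (d * k) := fun x => by
    rw [TorusPolymer.card_blockOf hMt hsodd htodd x, hs, ← pow_mul, mul_comm]
  have hF : ∀ B ∈ blocks s X, TayNormLE (P.gauge k B) r₀ (expWeight (G k B))
      (fun ψ => expNegH H B ψ - 1)
      (8 * Real.exp (1 / 4) * hamNorm (fieldWt h (L : ℝ) d k) ((L : ℝ) ^ k) (L ^ (d * k)) H) := by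
    intro B hBm
    obtain ⟨x, -, rfl⟩ := mem_blocks.1 hBm
    have hH' : hamNorm (fieldWt h (L : ℝ) d k) ((L : ℝ) ^ k) (blockOf s x).card H ≤ 1 / 8 := by
      rw [hcard x]; exact hH
    have := tayNormLE_expNegH_sub_one_strong_abkm (R := R) (N := N) (Mord := Mord) hd hLodd hM hkN' hh
      hMord hp (TorusPolymer.subset_thicken (P.rad k) (blockOf s x)) r₀ hH'
    rw [hcard x] at this
    exact this
  have hFd : ∀ B ∈ blocks s X, ContDiff ℝ r₀ (fun ψ : (Fin d → ZMod M) → ℝ => expNegH H B ψ - 1) :=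
    fun B _ => ((contDiff_eval H B (n := r₀)).neg.cexp).sub contDiff_const
  have hFloc : ∀ B ∈ blocks s X, IsGaugeLocal (P.gauge k B)
      (fun ψ : (Fin d → ZMod M) → ℝ => expNegH H B ψ - 1) := fun B _ =>
    IsGaugeLocal.op₁ _ (fun z : ℂ => z - 1) (isGaugeLocal_cexp_neg_eval h𝔥.ne' hR.ne' hp
      (TorusPolymer.subset_thicken _ _) H)
  have hleb : ∀ B ∈ blocks s X, ∀ ξ, ‖P.gauge k B ξ‖ ≤ ‖P.gauge k X ξ‖ := fun B hBm =>
    hgauge B (hX.subset_of_mem_blocks hBm)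
  have ha : ∀ B ∈ blocks s X, (0 : ℝ) ≤
      8 * Real.exp (1 / 4) * hamNorm (fieldWt h (L : ℝ) d k) ((L : ℝ) ^ k) (L ^ (d * k)) H :=
    fun _ _ => by
      have := hamNorm_nonneg (fieldWt_pos hh hL0 d k).le (by positivity : (0 : ℝ) ≤ (L : ℝ) ^ k)
        (L ^ (d * k)) H
      positivity
  -- `K` on the sub-polymers `Y ⊆ X`: Lemma 8.3 (i)
  have hwU : ∀ X' Y', IsPolymer s X' → IsPolymer s Y' → Separated (s + 1) X' Y' →
      ∀ φ, W.weight k (X' ∪ Y') φ = W.weight k X' φ * W.weight k Y' φ := fun X' Y' _ _ hsep φ =>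
    WeightData.weight_union hB.dominated hB.isLocal hB.additive (k := k) hsep φ
  have hw0 : ∀ φ, W.weight k ∅ φ = 1 := weight_empty_of_union hwU (fun φ => W.weight_pos k ∅ φ)
  have hMo : Odd M := by rw [hM]; exact hLodd.pow
  have hsubZ : ∀ {Y Z : Finset (Fin d → ZMod M)}, Z ∈ components Y → Z ⊆ Y := fun {Y Z} hZ => by
    rw [Literature.Barriers.CriticalPhenomena.LongRangePhi4.Polymer.eq_biUnion_components Y]
    exact Finset.subset_biUnion_of_mem id hZ
  have hKY : ∀ Y ∈ polys s X, TayNormLE (P.gauge k Y) r₀ (W.weight k Y) (K Y)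
      (∏ Z ∈ components Y, C * P.aFactor k Z) := by
    intro Y hY
    obtain ⟨hYX, hYp⟩ := mem_polys.1 hY
    refine tayNormLE_of_factorises hMt hsodd htodd (P.gauge k Y) (fun Z => P.gauge k Z) hwU hw0 hKfac hK0 hYp
      (fun Z hZ => ?_) (fun Z hZ ξ => ?_) (fun Z _ => hKd Z) (fun Z hZ => ?_) (fun Z _ => ?_)
    · obtain ⟨hZp, hZc⟩ := TorusPolymer.IsPolymer.of_mem_components hMo hsodd hYp hZ
      exact hK Z hZp hZc
    · exact norm_fieldGauge_mono_set _ _ _ (TorusPolymer.thicken_mono _ (hsubZ hZ)) ξ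
    · obtain ⟨hZp, hZc⟩ := TorusPolymer.IsPolymer.of_mem_components hMo hsodd hYp hZ
      exact hKloc Z hZp hZc
    · exact mul_nonneg hC (WeakNormLE.aFactor_pos hA k Z).le
  have hlep : ∀ Y ∈ polys s X, ∀ ξ, ‖P.gauge k Y ξ‖ ≤ ‖P.gauge k X ξ‖ := fun Y hY =>
    hgauge Y (mem_polys.1 hY).1
  have hKlocY : ∀ Y ∈ polys s X, IsGaugeLocal (P.gauge k Y) (K Y) := by
    intro Y hY
    obtain ⟨hYX, hYp⟩ := mem_polys.1 hY
    have hpoly : ∀ Z ∈ components Y, IsPolymer s Z := fun Z hZ =>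
      (TorusPolymer.IsPolymer.of_mem_components hMo hsodd hYp hZ).1
    have hsep := TorusPolymer.pairwise_separated_components hMt hsodd htodd hYp
    have hKeq : K Y = fun φ => ∏ Z ∈ components Y, K Z φ := by
      funext φ
      conv_lhs => rw [Literature.Barriers.CriticalPhenomena.LongRangePhi4.Polymer.eq_biUnion_components Y]
      exact eq_prod_of_factorises hKfac hK0 _ hpoly hsep φ
    rw [hKeq]
    refine IsGaugeLocal.prod _ fun Z hZ => ?_
    obtain ⟨hZp, hZc⟩ := TorusPolymer.IsPolymer.of_mem_components hMo hsodd hYp hZ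
    exact (hKloc Z hZp hZc).of_norm_le fun ξ => norm_fieldGauge_mono_set _ _ _ (TorusPolymer.thicken_mono _ (hsubZ hZ)) ξ
  have hc : ∀ Y ∈ polys s X, (0 : ℝ) ≤ ∏ Z ∈ components Y, C * P.aFactor k Z := fun Y _ =>
    Finset.prod_nonneg fun Z _ => mul_nonneg hC (WeakNormLE.aFactor_pos hA k Z).le
  have hw : ∀ Y ∈ polys s X, ∀ φ, (∏ B ∈ blocks s (X \ Y), expWeight (G k B) φ) * W.weight k Y φ ≤
      W.weight k X φ := fun Y hY φ =>
    weight_mul_prod_strongWeight_le hB.dominated hB.monotone hGs k s hX (mem_polys.1 hY).2 (mem_polys.1 hY).1 φ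
  exact tayNormLE_subsum_bprod_mul s (P.gauge k X) (fun B => P.gauge k B) (fun Y => P.gauge k Y) X h𝓨
    hF hleb hFd hFloc ha hKY hlep (fun Y _ => hKd Y) hKlocY hc hw

end Literature.MathematicalPhysics.StatisticalMechanics.GradientRG

end
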